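import Summits.HodgeConjecture.CorCM.Census.DecicWeil23TripleParts
import Summits.HodgeConjecture.CorCM.DecicWeil23PairFrameTransfer
import Summits.HodgeConjecture.CorCM.OcticWeilOrbitFrameTransfer
import HarnessLib

/-!
# COR-CM — three `(2,3)`-types over one DECIC CM field `K ⊇ k`: `E × B₁ × B₂ × B₃` — FRAME TRANSFER (Galois-balanced weights of
# every product of copies are model-balanced under `A₅`-realisation), the divisor lines of conjugate pairs, and the type count

Cell `pub-hodgecm2` (COR-CM), seat b30 gen 22 (2026-08-22); count-neutral own lane DECIC-WEIL-23PAIR, part TRIPLE, over the kernel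
census `Census/DecicWeil23Triple{,Defect,Parts,Extraction}`.  Theorems, plus ONE bookkeeping definition (the model map `toPtT`; the
slot map `(i₀, i₁, i₁, i₁) : Fin 4 → I` is gen 20's `OcticWeilOrbit.orbitSlots` BY NAME, and the realiser lemmas
`apply_comp_eq_of_realisesD` / `comp_eq_tau_iff_of_realisesD` are those of `CorCM/DecicWeil23PairFrameTransfer`); no named fact,
no `sorry`.  The three-slot twin of `CorCM/DecicWeil23PairFrameTransfer`: `E = A₄ 0 ⊨ (k; {τ})` (`hΨ`), `B_{m+1} = A₄ (m+1) ⊨ (K; Φ_m)`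
with `s ∈ Φ_m ⟺ (e s).2 = inPosT c m (e s).1` (`hΦ`, shape `c : Fin 8`).

* §1 the model map `toPtT` (cases, injectivity, conjugation), membership `ρ ∘ x ∈ Φ₄ ⟺ toPtT x ∈ phiT c r` for a realiser of `permD r`;
* §2 **`modelBalancedT_of_isGaloisBalancedAlg`** — FRAME TRANSFER for every slot map `κ : Fin N → Fin 4`;
* §3 `weightClassesAlg_le_algebraicClasses_of_isPairPartT` (pair parts have divisor lines);
* §4 `typeCount_eq_three_of_reading₅` — any reading `s ∈ Φ ⟺ (e s).2 = P (e s).1` with `#P = 2` has type count `(3,3)` with `{τ}`.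
HONEST FRAMING: nothing about the Hodge conjecture is concluded here; `HC_CM` is not asserted.
[cite: Pohlmann1968, Thm 1] [cite: GaoUllmo2025, Thm 3.1 (3.2)] [cite: Shimura1998, §18.2 Lemma (i)]
[cite: Gordon1999HodgeAVSurvey, 9.2.2] [cite: Milne2020HodgeClassesAV, 1.2 (a) and Thm. 1] [cite: Deligne1982HodgeCycles, §4 Prop. 4.4]

## References
* [Pohlmann1968] Ann. of Math. 88 (1968), Thm 1.  [GaoUllmo2025] J. Inst. Math. Jussieu 25 (2025), Thm 3.1 (3.2).  [Shimura1998]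
  G. Shimura, *Abelian varieties with CM and modular functions*, §18.2 Lemma (i).  [Gordon1999HodgeAVSurvey] CRM Monogr. 10
  (1999), 9.2.2.  [Milne2020HodgeClassesAV] arXiv:2010.08857, 1.2 (a), Thm. 1.  [Deligne1982HodgeCycles] LNM 900, §4 Prop. 4.4.
-/

noncomputable section

open CategoryTheory CategoryTheory.Limits NumberField

namespace Summit.HodgeConjecture.CorCM.DecicWeil23Triple

open Literature.AlgebraicGeometry Literature.AlgebraicGeometry.Motives Literature.AlgebraicGeometry.HodgeTheory
open Literature.AlgebraicGeometry.ComplexMultiplication (IsCMTypeRealisation)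
open Literature.AlgebraicGeometry.Pohlmann1968
open Literature.AlgebraicTopology.SingularHomology
open Literature.NumberTheory.ComplexMultiplication
open Summit.HodgeConjecture.CorCM.Census.DecicWeil23Pair (permD permD_facts)
open Summit.HodgeConjecture.CorCM.Census.DecicWeil23Triple (PtT cjT cjT_inl cjT_inr cjT_facts inPosT signTabT
  card_inPosT phiT inl_mem_phiT inr_mem_phiT ModelBalancedT IsPairPartT)
open Summit.HodgeConjecture.CorCM.DecicWeil23Pair (apply_comp_eq_of_realisesD comp_tau_eq_of_realisesD comp_eq_tau_iff_of_realisesD)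
open Summit.HodgeConjecture.CorCM.OcticWeilOrbit (orbitSlots sigma_cases₃ conj_smul_zero₃ conj_smul_succ₃)
open Summit.HodgeConjecture.CorCM.OcticCurveFourfold (comp_injective comp_conjugate)
open Summit.HodgeConjecture.CorCM.CMWeights (weightClassesAlg_comp_le_algebraicClasses_of_injOn)
open Summit.HodgeConjecture.CorCM.PairWeights
open Summit.HodgeConjecture.CorCM.DihedralSexticPairCurvePowers (ncard_sep_eq_card_filter)
open Summit.HodgeConjecture.CorCM.DihedralSexticPair (card_filter_equiv_mem)

open scoped Classical Pointwise

/-! ## §0 The model map -/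

section Defs

variable {I : Type} {Kf : I → Type} [∀ i, Field (Kf i)] {i₀ i₁ : I}

/-- **The model map** `Hom(k × K × K × K, ℂ) → PtT`: `(0, σ) ↦ inl [σ = τ]`, `(m+1, s) ↦ inr (m, e s)` (slots `OcticWeilOrbit.orbitSlots
i₀ i₁ = (i₀, i₁, i₁, i₁)`). [folklore] -/
def toPtT (e : (Kf i₁ →+* ℂ) ≃ Fin 5 × Bool) (τ : Kf i₀ →+* ℂ) :
    ((j : Fin 4) × (Kf (orbitSlots i₀ i₁ j) →+* ℂ)) → PtT := fun x =>
  Fin.cases (motive := fun j => (Kf (orbitSlots i₀ i₁ j) →+* ℂ) → PtT)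
    (fun σ => Sum.inl (decide (σ = τ))) (fun m s => Sum.inr (m, e s)) x.1 x.2

/-- `toPtT` on the curve slot. [folklore] -/
@[simp] theorem toPtT_zero (e : (Kf i₁ →+* ℂ) ≃ Fin 5 × Bool) (τ : Kf i₀ →+* ℂ) (σ : Kf i₀ →+* ℂ) :
    toPtT e τ ⟨0, σ⟩ = Sum.inl (decide (σ = τ)) := rfl

/-- `toPtT` on the fivefold slots. [folklore] -/
@[simp] theorem toPtT_succ (e : (Kf i₁ →+* ℂ) ≃ Fin 5 × Bool) (τ : Kf i₀ →+* ℂ) (m : Fin 3) (s : Kf i₁ →+* ℂ) :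
    toPtT e τ ⟨m.succ, s⟩ = Sum.inr (m, e s) := rfl

end Defs

/-! ## §1 The model map: cases, injectivity, conjugation; how a realiser of `permD r` acts -/

section Transfer

variable {I : Type} {Kf : I → Type} [∀ i, Field (Kf i)]
  {i₀ i₁ : I} {e : (Kf i₁ →+* ℂ) ≃ Fin 5 × Bool} {τ : Kf i₀ →+* ℂ}
  (hττ : ComplexEmbedding.conjugate τ ≠ τ) (hk : ∀ σ : Kf i₀ →+* ℂ, σ = τ ∨ σ = ComplexEmbedding.conjugate τ)

include hττ hk in
/-- The model map is injective (`Hom(k, ℂ) = {τ, τ̄}`, `e` a bijection, the slot is recorded). [folklore] -/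
theorem toPtT_injective : Function.Injective (toPtT (i₀ := i₀) (i₁ := i₁) e τ) := by
  intro x y hxy
  rcases sigma_cases₃ x with ⟨σ, rfl⟩ | ⟨m, s, rfl⟩ <;> rcases sigma_cases₃ y with ⟨σ', rfl⟩ | ⟨m', s', rfl⟩
  · rw [toPtT_zero, toPtT_zero, Sum.inl.injEq] at hxy
    rcases hk σ with rfl | rfl <;> rcases hk σ' with rfl | rfl
    · rfl
    · simp only [decide_true] at hxy; exact absurd (of_decide_eq_true hxy.symm) hττ
    · simp only [decide_true] at hxy; exact absurd (of_decide_eq_true hxy) hττ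
    · rfl
  · exact absurd hxy (by rw [toPtT_zero, toPtT_succ]; exact Sum.inl_ne_inr)
  · exact absurd hxy (by rw [toPtT_zero, toPtT_succ]; exact Sum.inr_ne_inl)
  · rw [toPtT_succ, toPtT_succ, Sum.inr.injEq, Prod.mk.injEq] at hxy
    obtain ⟨rfl, h2⟩ := hxy
    rw [e.injective h2]

variable {i : Kf i₀ →+* Kf i₁}
  (he_sign : ∀ s : Kf i₁ →+* ℂ, (e s).2 = true ↔ s.comp i = τ)
  (he_conj : ∀ s : Kf i₁ →+* ℂ, e (ComplexEmbedding.conjugate s) = ((e s).1, !(e s).2))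

include he_conj hττ hk in
/-- Conjugation is read in the model: `toPtT x̄ = cjT (toPtT x)`. [folklore] -/
theorem toPtT_conj_smul (x : (j : Fin 4) × (Kf (orbitSlots i₀ i₁ j) →+* ℂ)) :
    toPtT e τ ((starRingAut : ℂ ≃+* ℂ) • x) = cjT (toPtT e τ x) := by
  rcases sigma_cases₃ x with ⟨σ, rfl⟩ | ⟨m, s, rfl⟩
  · have key : decide (ComplexEmbedding.conjugate σ = τ) = !decide (σ = τ) := by
      rcases hk σ with rfl | rfl
      · rw [decide_eq_false hττ]; simp
      · rw [ComplexEmbedding.involutive_conjugate, decide_eq_false hττ]; simp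
    rw [conj_smul_zero₃, toPtT_zero, toPtT_zero, key, cjT_inl]
  · rw [conj_smul_succ₃, toPtT_succ, toPtT_succ, he_conj, cjT_inr]

variable {c : Fin 8} {Φ₄ : ∀ j : Fin 4, CMType (Kf (orbitSlots i₀ i₁ j))}
  (hΦ : ∀ (m : Fin 3) (s : Kf i₁ →+* ℂ), s ∈ (Φ₄ m.succ).1 ↔ (e s).2 = inPosT c m (e s).1)
  (hΨ : ∀ σ : Kf i₀ →+* ℂ, σ ∈ (Φ₄ 0).1 ↔ σ = τ)

include he_conj hΦ in
/-- **How a realiser of `permD r` acts on a fivefold slot of type `m`**: `ρ ∘ s ∈ Φ_m ⟺ inr (m, e s) ∈ phiT c r`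
(`ρ` keeps signs and moves the pair `a` to `permD r a`; `signTabT c r m a = [permD r a ∈ I_m]`). [cite: GaoUllmo2025, Thm 3.1 (3.2)] -/
theorem comp_mem_iff_of_realisesT [NumberField (Kf i₁)] [IsCMField (Kf i₁)] (ρ : ℂ ≃+* ℂ) {r : Fin 60}
    (hρ : ∀ a : Fin 5, (ρ : ℂ →+* ℂ).comp (e.symm (a, true)) = e.symm (permD r a, true)) (m : Fin 3)
    (s : Kf i₁ →+* ℂ) : (ρ : ℂ →+* ℂ).comp s ∈ (Φ₄ m.succ).1 ↔ (Sum.inr (m, e s) : PtT) ∈ phiT c r := by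
  rw [hΦ, apply_comp_eq_of_realisesD he_conj ρ hρ s, inr_mem_phiT]
  exact Iff.rfl

include hττ hk he_sign he_conj hΦ hΨ in
/-- **Membership read in the frame**: for a realiser `ρ` of `permD r`, `ρ ∘ x ∈ Φ₄ ↔ toPtT x ∈ phiT c r` (on the curve slot
`ρ` fixes `τ`, and `inl b ∈ phiT c r ↔ b = true`). [cite: GaoUllmo2025, Thm 3.1 (3.2)] -/
theorem comp_mem_iff_toPtT_mem [NumberField (Kf i₁)] [IsCMField (Kf i₁)] {ρ : ℂ ≃+* ℂ} {r : Fin 60}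
    (hρ : ∀ a : Fin 5, (ρ : ℂ →+* ℂ).comp (e.symm (a, true)) = e.symm (permD r a, true))
    (x : (j : Fin 4) × (Kf (orbitSlots i₀ i₁ j) →+* ℂ)) :
    (ρ : ℂ →+* ℂ).comp x.2 ∈ (Φ₄ x.1).1 ↔ toPtT e τ x ∈ phiT c r := by
  rcases sigma_cases₃ x with ⟨σ, rfl⟩ | ⟨m, s, rfl⟩
  · change (ρ : ℂ →+* ℂ).comp σ ∈ (Φ₄ 0).1 ↔ _
    rw [hΨ, toPtT_zero, inl_mem_phiT, comp_eq_tau_iff_of_realisesD hττ hk he_sign ρ hρ σ]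
    exact ⟨fun h => decide_eq_true h, fun h => of_decide_eq_true h⟩
  · exact comp_mem_iff_of_realisesT he_conj hΦ ρ hρ m s

/-! ## §2 Frame transfer for the products of copies -/

variable {N : ℕ} (κ : Fin N → Fin 4)

include hττ hk he_sign he_conj hΦ hΨ in
/-- **FRAME TRANSFER** (`A₅`-realisation): an `Aut(ℂ)`-balanced weight of `X = ⨁_j A₄(κ j)` (`IsGaloisBalancedAlg` for the CM
algebra `∏_j K_{κ j}`, types `Φ₄ (κ j)`) is a balanced configuration of the model of `Census/DecicWeil23Triple` under
`v = toPtT e τ ∘ P`, `P (j, s) = (κ j, s)`: each even permutation `permD r` of the conjugate pairs is realised by an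
automorphism of `ℂ` (`hgal`), whose balance condition is the model's `r`-th equation.
[cite: GaoUllmo2025, Thm 3.1 (3.2)] [cite: Pohlmann1968, Thm 1] -/
theorem modelBalancedT_of_isGaloisBalancedAlg [NumberField (Kf i₁)] [IsCMField (Kf i₁)]
    (hgal : ∀ r : Fin 60, ∃ ρ : ℂ ≃+* ℂ,
      ∀ a : Fin 5, (ρ : ℂ →+* ℂ).comp (e.symm (a, true)) = e.symm (permD r a, true))
    {S : Finset ((j : Fin N) × (Kf (orbitSlots i₀ i₁ (κ j)) →+* ℂ))}
    (hS : IsGaloisBalancedAlg (K := fun j => Kf (orbitSlots i₀ i₁ (κ j))) (fun j => Φ₄ (κ j)) S) :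
    ModelBalancedT c (fun x => toPtT e τ ((Sigma.map κ (fun _ => id) :
      ((j : Fin N) × (Kf (orbitSlots i₀ i₁ (κ j)) →+* ℂ)) → ((m : Fin 4) × (Kf (orbitSlots i₀ i₁ m) →+* ℂ))) x)) S := by
  intro r
  beta_reduce
  obtain ⟨ρ, hρ⟩ := hgal r
  have h := hS ρ
  rw [ncard_sep_eq_card_filter, ncard_sep_eq_card_filter] at h
  have key : ∀ x : (j : Fin N) × (Kf (orbitSlots i₀ i₁ (κ j)) →+* ℂ),
      (ρ : ℂ →+* ℂ).comp x.2 ∈ (Φ₄ (κ x.1)).1 ↔ toPtT e τ ((Sigma.map κ (fun _ => id) :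
        ((j : Fin N) × (Kf (orbitSlots i₀ i₁ (κ j)) →+* ℂ)) → ((m : Fin 4) × (Kf (orbitSlots i₀ i₁ m) →+* ℂ))) x)
          ∈ phiT c r :=
    fun x => comp_mem_iff_toPtT_mem hττ hk he_sign he_conj hΦ hΨ hρ ⟨κ x.1, x.2⟩
  rw [Finset.filter_congr fun x _ => key x, Finset.filter_congr fun x _ => (key x).not] at h
  have htot := Finset.card_filter_add_card_filter_not
    (s := S) (fun x => toPtT e τ ((Sigma.map κ (fun _ => id) :
        ((j : Fin N) × (Kf (orbitSlots i₀ i₁ (κ j)) →+* ℂ)) → ((m : Fin 4) × (Kf (orbitSlots i₀ i₁ m) →+* ℂ))) x)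
          ∈ phiT c r)
  omega

end Transfer

/-! ## §3 Conjugate pairs have algebraic (divisor) lines -/

section Pairs

variable {I : Type} {Kf : I → Type} [∀ i, Field (Kf i)] [∀ i, NumberField (Kf i)] [∀ i, IsCMField (Kf i)]
  {i₀ i₁ : I} {N : ℕ} (κ : Fin N → Fin 4) {e : (Kf i₁ →+* ℂ) ≃ Fin 5 × Bool} {τ : Kf i₀ →+* ℂ}
  (hττ : ComplexEmbedding.conjugate τ ≠ τ) (hk : ∀ σ : Kf i₀ →+* ℂ, σ = τ ∨ σ = ComplexEmbedding.conjugate τ)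
  (he_conj : ∀ s : Kf i₁ →+* ℂ, e (ComplexEmbedding.conjugate s) = ((e s).1, !(e s).2))
  {A₄ : Fin 4 → AbelianVariety ℂ} {Φ₄ : ∀ j : Fin 4, CMType (Kf (orbitSlots i₀ i₁ j))}
  {ι₄ : ∀ j, 𝓞 (Kf (orbitSlots i₀ i₁ j)) →+* End (A₄ j)}
  {θ₄ : ∀ j, Kf (orbitSlots i₀ i₁ j) →+* Module.End ℂ (complexBetti (A₄ j).X 1)}
  (hA : ∀ j, IsCMTypeRealisation (Φ₄ j) (A₄ j) (ι₄ j) (θ₄ j))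

include hττ hk he_conj hA in
/-- **A weight of `Y = ⨁ A₄` whose model image is a conjugate pair `{y, cjT y}` is conjugation-stable, so its line is
algebraic** (a divisor line: Lefschetz `(1,1)` on the abelian variety `⨁ A₄`). [cite: Gordon1999HodgeAVSurvey, 9.2.2] -/
theorem weightClassesAlg_le_algebraicClasses_of_image_eq_pairT
    {T : Finset ((j : Fin 4) × (Kf (orbitSlots i₀ i₁ j) →+* ℂ))} {y : PtT} (hT : T.image (toPtT e τ) = {y, cjT y}) :
    T.card = 2 ∧ weightClassesAlg A₄ ι₄ (2 * 1) T ≤ algebraicClasses (⨁ A₄).X 1 := by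
  have hinj := toPtT_injective (e := e) hττ hk (i₁ := i₁)
  have hcard : T.card = 2 := by
    rw [← Finset.card_image_of_injective T hinj, hT]
    exact Finset.card_pair (cjT_facts.2 y).symm
  refine ⟨hcard, weightClassesAlg_le_algebraicClasses_of_conj_smul_mem hA (m := 1) hcard fun x hx => ?_⟩
  have hx' : toPtT e τ x ∈ ({y, cjT y} : Finset PtT) := hT ▸ Finset.mem_image_of_mem _ hx
  have hcx : toPtT e τ ((starRingAut : ℂ ≃+* ℂ) • x) ∈ T.image (toPtT e τ) := by
    rw [toPtT_conj_smul hττ hk he_conj x, hT, Finset.mem_insert, Finset.mem_singleton] at *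
    rcases hx' with h | h
    · exact Or.inr (by rw [h])
    · exact Or.inl (by rw [h, cjT_facts.1])
  exact (hinj.mem_finset_image).1 hcx

include hττ hk he_conj hA in
/-- **A pair part of a weight of `X = ⨁_j A₄(κ j)` has an algebraic (divisor) line**: the model map is injective on it with
image a conjugate pair, so its slot projection to `Y = ⨁ A₄` is a weight with the same image — a divisor line — and seat b30's
distribution lemma lifts it along `κ`. [cite: Gordon1999HodgeAVSurvey, 9.2.2] [cite: Milne2020HodgeClassesAV, 1.2 (a) and Thm. 1] -/
theorem weightClassesAlg_le_algebraicClasses_of_isPairPartT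
    {G : Finset ((j : Fin N) × (Kf (orbitSlots i₀ i₁ (κ j)) →+* ℂ))}
    (hG : IsPairPartT (fun x => toPtT e τ ((Sigma.map κ (fun _ => id) :
      ((j : Fin N) × (Kf (orbitSlots i₀ i₁ (κ j)) →+* ℂ)) → ((m : Fin 4) × (Kf (orbitSlots i₀ i₁ m) →+* ℂ))) x)) G) :
    G.card = 2 * 1 ∧ weightClassesAlg (fun j => A₄ (κ j)) (fun j => ι₄ (κ j)) (2 * 1) G ≤
      algebraicClasses (⨁ fun j => A₄ (κ j)).X 1 := by
  obtain ⟨y, hcard, hinj, himg⟩ := hG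
  set P : ((j : Fin N) × (Kf (orbitSlots i₀ i₁ (κ j)) →+* ℂ)) → ((m : Fin 4) × (Kf (orbitSlots i₀ i₁ m) →+* ℂ)) :=
    Sigma.map κ (fun _ => id) with hP
  have hPinj : Set.InjOn P ↑G := fun x hx x' hx' h => hinj hx hx' (by change toPtT e τ (P x) = toPtT e τ (P x'); rw [h])
  set TY : Finset ((m : Fin 4) × (Kf (orbitSlots i₀ i₁ m) →+* ℂ)) := G.image P with hTY
  have hTYimg : TY.image (toPtT e τ) = {y, cjT y} := by rw [hTY, Finset.image_image]; exact himg
  obtain ⟨-, hYalg⟩ := weightClassesAlg_le_algebraicClasses_of_image_eq_pairT hττ hk he_conj hA hTYimg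
  have hq : G.card = 2 * 1 := by rw [hcard]
  exact ⟨hq, weightClassesAlg_comp_le_algebraicClasses_of_injOn (K := fun m => Kf (orbitSlots i₀ i₁ m)) hA κ hq
    hPinj hYalg⟩

end Pairs

/-! ## §4 The type count `(2 + 1, 3 + 0) = (3, 3)` of any `(2,3)`-reading -/

section Counts

variable {I : Type} {Kf : I → Type} [∀ i, Field (Kf i)] [∀ i, NumberField (Kf i)] [∀ i, IsCMField (Kf i)]
  {i₀ i₁ : I} {e : (Kf i₁ →+* ℂ) ≃ Fin 5 × Bool} {τ : Kf i₀ →+* ℂ} {i : Kf i₀ →+* Kf i₁}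

/-- **A `(2,3)`-reading has exactly TWO members over `τ` and THREE over `τ̄`**: for `s ∈ Φ ⟺ (e s).2 = P (e s).1` with
`#{a | P a} = 2`, and `Ψ = {τ}`, the count `#{s ∈ Φ | s ∘ i = τ'} + [τ' ∈ Ψ]` is `3` for both `τ' = τ, τ̄` — the Weil-type condition
`(3,3)` of seat b09's `DecicCurveFivefold.weilClassesOf_le_algebraicClasses_cmFivefold_prod_cmCurve_of_markmanSixfold` for `B × E`.
[cite: Deligne1982HodgeCycles, §4 Prop. 4.4] -/
theorem typeCount_eq_three_of_reading₅ (h2 : Module.finrank ℚ (Kf i₀) = 2)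
    (he_sign : ∀ s : Kf i₁ →+* ℂ, (e s).2 = true ↔ s.comp i = τ) {P : Fin 5 → Bool}
    (hP : ((Finset.univ : Finset (Fin 5)).filter fun a => P a = true).card = 2)
    {Φ : CMType (Kf i₁)} (hΦ : ∀ s : Kf i₁ →+* ℂ, s ∈ Φ.1 ↔ (e s).2 = P (e s).1)
    {Ψ : CMType (Kf i₀)} (hΨ : ∀ σ : Kf i₀ →+* ℂ, σ ∈ Ψ.1 ↔ σ = τ) (τ' : Kf i₀ →+* ℂ) :
    (Finset.univ.filter fun s : Kf i₁ →+* ℂ => s.comp i = τ' ∧ s ∈ Φ.1).card + (if τ' ∈ Ψ.1 then 1 else 0) = 3 := by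
  have hττ : ComplexEmbedding.conjugate τ ≠ τ := QuarticCM.conjugate_ne τ
  have hk : ∀ σ : Kf i₀ →+* ℂ, σ = τ ∨ σ = ComplexEmbedding.conjugate τ := fun σ =>
    QuarticCM.eq_or_eq_conjugate_of_quadratic h2 τ σ
  have hPfalse : ((Finset.univ : Finset (Fin 5)).filter fun a => P a = false).card = 3 := by
    have h := Finset.card_filter_add_card_filter_not (s := (Finset.univ : Finset (Fin 5))) (fun a => P a = true)
    rw [hP, Finset.card_univ, Fintype.card_fin] at h
    have h' : ((Finset.univ : Finset (Fin 5)).filter fun a => ¬ P a = true) =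
        (Finset.univ : Finset (Fin 5)).filter fun a => P a = false :=
      Finset.filter_congr fun a _ => by cases P a <;> simp
    rw [h'] at h
    omega
  -- the count through the frame, for either sign
  have hcount : ∀ b : Bool, (Finset.univ.filter fun s : Kf i₁ →+* ℂ => (e s).2 = b ∧ s ∈ Φ.1).card =
      ((Finset.univ : Finset (Fin 5)).filter fun a => P a = b).card := by
    intro b
    have hfilter : (Finset.univ.filter fun s : Kf i₁ →+* ℂ => (e s).2 = b ∧ s ∈ Φ.1) =
        Finset.univ.filter fun s => e s ∈ ((Finset.univ : Finset (Fin 5 × Bool)).filter fun p => p.2 = b ∧ P p.1 = b) := by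
      refine Finset.filter_congr fun s _ => ?_
      rw [hΦ s, Finset.mem_filter]
      constructor
      · rintro ⟨h1, h2⟩; exact ⟨Finset.mem_univ _, h1, by rw [← h2, h1]⟩
      · rintro ⟨-, h1, h2⟩; exact ⟨h1, by rw [h1, h2]⟩
    have hprod : ((Finset.univ : Finset (Fin 5 × Bool)).filter fun p => p.2 = b ∧ P p.1 = b).card =
        ((Finset.univ : Finset (Fin 5)).filter fun a => P a = b).card := by
      refine Finset.card_bij (fun p _ => p.1) (fun p hp => ?_) (fun p hp q hq h => ?_) (fun a ha => ?_)
      · exact Finset.mem_filter.2 ⟨Finset.mem_univ _, (Finset.mem_filter.1 hp).2.2⟩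
      · obtain ⟨-, hp2, -⟩ := Finset.mem_filter.1 hp
        obtain ⟨-, hq2, -⟩ := Finset.mem_filter.1 hq
        exact Prod.ext h (hp2.trans hq2.symm)
      · exact ⟨(a, b), Finset.mem_filter.2 ⟨Finset.mem_univ _, rfl, (Finset.mem_filter.1 ha).2⟩, rfl⟩
    rw [hfilter, card_filter_equiv_mem, hprod]
  rcases hk τ' with rfl | rfl
  · rw [if_pos ((hΨ _).2 rfl)]
    have hfilter : (Finset.univ.filter fun s : Kf i₁ →+* ℂ => s.comp i = τ' ∧ s ∈ Φ.1) =
        Finset.univ.filter fun s : Kf i₁ →+* ℂ => (e s).2 = true ∧ s ∈ Φ.1 :=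
      Finset.filter_congr fun s _ => by rw [he_sign]
    rw [hfilter, hcount, hP]
  · have hnot : ComplexEmbedding.conjugate τ ∉ Ψ.1 := fun h => hττ ((hΨ _).1 h)
    rw [if_neg hnot, add_zero]
    have hsnd : ∀ s : Kf i₁ →+* ℂ, s.comp i = ComplexEmbedding.conjugate τ ↔ (e s).2 = false := by
      intro s
      constructor
      · intro h
        cases hs : (e s).2
        · rfl
        · exact absurd (((he_sign s).1 hs).symm.trans h) hττ.symm
      · exact fun h => (hk (s.comp i)).resolve_left fun h' => absurd ((he_sign s).2 h') (by rw [h]; exact Bool.false_ne_true)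
    have hfilter : (Finset.univ.filter fun s : Kf i₁ →+* ℂ => s.comp i = ComplexEmbedding.conjugate τ ∧ s ∈ Φ.1) =
        Finset.univ.filter fun s : Kf i₁ →+* ℂ => (e s).2 = false ∧ s ∈ Φ.1 :=
      Finset.filter_congr fun s _ => by rw [hsnd]
    rw [hfilter, hcount, hPfalse]

end Counts

end Summit.HodgeConjecture.CorCM.DecicWeil23Triple

end
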